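import Literature.AlgebraicGeometry.Resolution.LocalBlowup
import Mathlib.Algebra.CharP.Lemmas
import Mathlib.RingTheory.LocalRing.MaximalIdeal.Basic
import HarnessLib

/-!
# Steer σ-residual, §σ2.32/§σ2.33 ORDER INDUCTION — N-REACH: «normalising the start reaches no new orders»

OURS (campaign `res-hironaka`, rung L ★L-G4, slot W4.1, crux `Steer` stmt-ResolutionOfSingularities-16345; res-L0-w41-plan-1
RULING 170b, res-L0-w41-strat-2 §σ2.33 word `NormalisedStartReachTwo` / `CleanerReaches` (candidate tree file
`…OrderInductionWords`); seat res-D-pv-003 gen 6). Theses-free and definition-free; nothing here is a statement of the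
manuscript under review [claim: Hironaka2017, status: under-review]; AI review is weaker than expert review.

The normalised start replaces the torsor generator `t` by `t₁` with `t = h · t₁ + g`, `g, h` in the SAME local ring `S`
(`SteeredRebase.rebase_of_model` at `A₁ := A₀` returns `locAtCentre A'.toSubring O = locAtCentre A₀.toSubring O`). In characteristic
`p`, `t ^ p = h ^ p · t₁ ^ p + g ^ p`, so a cleaner `g₁` of `t₁ ^ p` reaching order `d` (`t₁ ^ p − g₁ ^ p ∈ 𝔪_S ^ d`) gives the
cleaner `h · g₁ + g` of `t ^ p` reaching the same order: `t ^ p − (h g₁ + g) ^ p = h ^ p · (t₁ ^ p − g₁ ^ p) ∈ 𝔪_S ^ d`.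

* `reach_of_eq_mul_add` — the statement over an arbitrary local subring `S ⊆ K`;
* `cleanerReaches_body_of_rebase` — the `locAtCentre` form with strat-2's `CleanerReaches p O B t d` BODY on both sides
  (`∃ (_ : IsLocalRing (locAtCentre B O)) (ht : t ^ p ∈ locAtCentre B O) (g : locAtCentre B O), ⟨t ^ p, ht⟩ − g ^ p ∈ 𝔪 ^ d`),
  transported along `locAtCentre B' O = locAtCentre B O`; it closes the reach clause of `NormalisedStartReachTwo` by `exact` once
  the word lands. [folklore]
-/

noncomputable section

-- single-problem summit: the doubled namespace component `ResolutionOfSingularities` is forced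
set_option linter.dupNamespace false

namespace Summit.ResolutionOfSingularities.ResolutionOfSingularities.Theorems.SwitchingDichotomy.NormalStart

open IsLocalRing
open Literature.AlgebraicGeometry.Resolution

variable {K : Type} [Field K]

/-- **Frobenius on the re-based generator**: `t = h · t₁ + g` ⇒ `t ^ p − (h · g₁ + g) ^ p = h ^ p · (t₁ ^ p − g₁ ^ p)` in
characteristic `p`. [folklore] -/
theorem pow_sub_pow_rebase (p : ℕ) [hp : Fact p.Prime] [CharP K p] {t t₁ g h : K} (ht : t = h * t₁ + g) (g₁ : K) :
    t ^ p - (h * g₁ + g) ^ p = h ^ p * (t₁ ^ p - g₁ ^ p) := by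
  rw [ht, add_pow_char, add_pow_char, mul_pow, mul_pow]
  ring

/-- **N-REACH over a local subring**: if `t = h · t₁ + g` with `g, h ∈ S`, `t₁ ^ p ∈ S`, and a cleaner `g₁ ∈ S` of `t₁ ^ p` reaches
order `d` (`t₁ ^ p − g₁ ^ p ∈ 𝔪_S ^ d`), then `t ^ p ∈ S` and the cleaner `h · g₁ + g` of `t ^ p` reaches order `d`. [folklore] -/
theorem reach_of_eq_mul_add (p : ℕ) [Fact p.Prime] [CharP K p] (S : Subring K) [IsLocalRing S] {t t₁ g h : K}
    (hg : g ∈ S) (hh : h ∈ S) (ht : t = h * t₁ + g) (ht₁ : t₁ ^ p ∈ S) (g₁ : S) {d : ℕ}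
    (hd : (⟨t₁ ^ p, ht₁⟩ : S) - g₁ ^ p ∈ maximalIdeal S ^ d) :
    ∃ (ht' : t ^ p ∈ S) (g' : S), (⟨t ^ p, ht'⟩ : S) - g' ^ p ∈ maximalIdeal S ^ d := by
  have htp : t ^ p = h ^ p * t₁ ^ p + g ^ p := by rw [ht, add_pow_char, mul_pow]
  have ht' : t ^ p ∈ S := by
    rw [htp]
    exact S.add_mem (S.mul_mem (S.pow_mem hh p) ht₁) (S.pow_mem hg p)
  refine ⟨ht', ⟨h, hh⟩ * g₁ + ⟨g, hg⟩, ?_⟩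
  have key : (⟨t ^ p, ht'⟩ : S) - (⟨h, hh⟩ * g₁ + ⟨g, hg⟩) ^ p = ⟨h, hh⟩ ^ p * ((⟨t₁ ^ p, ht₁⟩ : S) - g₁ ^ p) := by
    apply Subtype.ext
    push_cast
    exact pow_sub_pow_rebase p ht (g₁ : K)
  rw [key]
  exact Ideal.mul_mem_left _ _ hd

/-- **N-REACH, `locAtCentre` form** (strat-2's `CleanerReaches p O B' t₁ d → CleanerReaches p O B t d` with both BODIES unfolded), along
`locAtCentre B' O = locAtCentre B O` and `t = h · t₁ + g`, `g, h ∈ locAtCentre B O`. [folklore] -/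
theorem cleanerReaches_body_of_rebase (p : ℕ) [Fact p.Prime] [CharP K p] (O : ValuationSubring K) {B B' : Subring K}
    (hS : locAtCentre B' O = locAtCentre B O) {t t₁ g h : K} (hg : g ∈ locAtCentre B O) (hh : h ∈ locAtCentre B O)
    (ht : t = h * t₁ + g) {d : ℕ}
    (hreach : ∃ (_ : IsLocalRing (locAtCentre B' O)) (ht₁ : t₁ ^ p ∈ locAtCentre B' O) (g₁ : locAtCentre B' O),
      (⟨t₁ ^ p, ht₁⟩ : locAtCentre B' O) - g₁ ^ p ∈ maximalIdeal (locAtCentre B' O) ^ d) :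
    ∃ (_ : IsLocalRing (locAtCentre B O)) (ht' : t ^ p ∈ locAtCentre B O) (g' : locAtCentre B O),
      (⟨t ^ p, ht'⟩ : locAtCentre B O) - g' ^ p ∈ maximalIdeal (locAtCentre B O) ^ d := by
  revert hreach
  generalize locAtCentre B' O = S' at hS
  subst hS
  rintro ⟨hloc, ht₁, g₁, hd⟩
  exact ⟨hloc, reach_of_eq_mul_add p (locAtCentre B O) hg hh ht ht₁ g₁ hd⟩

end Summit.ResolutionOfSingularities.ResolutionOfSingularities.Theorems.SwitchingDichotomy.NormalStart

end
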